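import Literature.AlgebraicTopology.SingularHomology.RelativeEilenbergRetractionProofs
import Literature.AlgebraicTopology.SingularHomology.RelativeHurewicz
import HarnessLib

/-!
# Relative Eilenberg retractions with the `1`-skeleton at the base point

Topic `Literature/AlgebraicTopology/SingularHomology`, continuing `RelativeEilenbergRetraction.lean`
and `RelativeEilenbergRetractionProofs.lean` (E. H. Spanier, *Algebraic Topology* (1966; Springer
1981), Ch. 7 §4, the subcomplex `Δ(X, A, x₀)ᵐ` of singular simplices with vertices at `x₀` and
`m`-skeleton in `A`, and the retraction `σ ↦ σ̄` of Lemma 7.4.7 / Thm. 7.4.8, p. 393). When `X`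
and `A` are both **simply connected**, the inductive construction of Thm. 7.4.8 can be run with one
more normalisation in dimension one: the edges, which after the level-`0` step are paths in `A` or
in `X` from `x₀` to `x₀`, are contracted to the constant path (inside `A` for edges of `A`, using
`π₁(A) = 0`; in `X` otherwise, using `π₁(X) = 0`), so that every retracted simplex sends its whole
**`1`-skeleton to `x₀`**. This is the normalisation under which Spanier's homotopy addition theorem
`Bₙ` (Ch. 7 §5 Prop. 3: `bₙ = h_{[v₀v₁]}[e⁰ₙ₊₁] + ∑ (-1)ⁱ[eⁱₙ₊₁]`, the zeroth face transported along
the edge `[v₀v₁]`) involves only constant transports; it is consumed in that role by the proof of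
the relative Hurewicz theorem for the cone classes (`RelativeHomotopyAdditionCone.lean`,
`RelativeHurewiczConeProofs.lean`).

* `IsRelEilenberg₁ A x₀ m σ` — `σ` maps the `m`-skeleton into `A` and the `1`-skeleton to `x₀`
  (hence is a relative Eilenberg simplex, `IsRelEilenberg₁.isRelEilenberg`); stable under faces.
* `RelEilenbergRetraction₁ X A x₀ m` (**structure**) — as `RelEilenbergRetraction` with
  `IsRelEilenberg₁` for `IsRelEilenberg`: `ρ` commuting with faces, with values such simplices,
  the identity on them, mapping simplices of `A` to simplices of `A`; its chain map `ρ♯`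
  (`chainMap`, `bd_chainMap`, `chainMap_single_of_isRelEilenberg₁`, `chainMap_mem_chainsIn`).
* **`exists_relEilenbergRetraction₁`** (PROVED) — for `X`, `↥A` simply connected and
  `π_q(X, A, b) = 0` for `1 ≤ q ≤ m` and all `b ∈ A`, such a retraction exists for every `x₀ ∈ A`:
  the tower of `RelativeEilenbergRetractionProofs.lean` (`LevelGood₁`, `exists_level_zero₁`,
  `exists_level_one₁`, `exists_level_succ_succ₁`) with the level-`1` fillings taken into the point
  `x₀` (`RelativeCompression.exists_fill_into` for the pairs `(↥A, {x₀})` and `(X, {x₀})`, whose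
  relative `π₁` vanish by `subsingleton_relHomotopyGroup_one_of_simplyConnectedSpace`).

Everything is proved; no named facts.

## References

* E. H. Spanier, *Algebraic Topology*, Springer (1981), Ch. 7 §4, Lemma 7 and Thm. 8 (p. 393); §5
  Prop. 3 (p. 395). [Spanier1981]
* A. Hatcher, *Algebraic Topology*, CUP (2002), §4.1 Lemma 4.7 (compression), Prop. 0.16.
  [HatcherAT2002]
-/

noncomputable section

-- see the implementation notes of `SingularChainsConcrete.lean` (chains are `Finsupp`s up to unfolding)
set_option backward.isDefEq.respectTransparency false

open Set Function
open scoped unitInterval Topology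
open Literature.AlgebraicTopology.Homotopy
open Literature.AlgebraicTopology.Homotopy.WhiteheadCW (tau tau_pos tau_lt_one tau_le_one tau_lt_succ)

universe u v

namespace Literature.AlgebraicTopology.SingularHomology

open SingularSimplex

variable {X : Type u} [TopologicalSpace X]

/-! ### Relative Eilenberg simplices with the `1`-skeleton at the base point -/

/-- **`σ : Δ^q → X` maps the `m`-skeleton into `A` and the `1`-skeleton to `x₀`** (a generator of
Spanier's `Δ(X, A, x₀)ᵐ`, p. 391, with the additional normalisation of its edges). [cite: Spanier1981, Ch. 7 §4 p. 391] -/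
def IsRelEilenberg₁ (A : Set X) (x₀ : X) (m : ℕ) {q : ℕ} (η : SingularSimplex X q) : Prop :=
  (∀ t ∈ stdSkel q m, SingularSimplex.toContinuousMap η t ∈ A) ∧
    ∀ t ∈ stdSkel q 1, SingularSimplex.toContinuousMap η t = x₀

namespace IsRelEilenberg₁

variable {A : Set X} {x₀ : X} {m : ℕ}

/-- The vertices are at `x₀`. [folklore] -/
lemma apply_vertex {q : ℕ} {η : SingularSimplex X q} (hσ : IsRelEilenberg₁ A x₀ m η) (i : Fin (q + 1)) :
    SingularSimplex.toContinuousMap η (stdSimplex.vertex (S := ℝ) i) = x₀ :=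
  hσ.2 _ (stdSkel_mono q (Nat.zero_le 1) (vertex_mem_stdSkel_zero i))

/-- Such a simplex is a relative Eilenberg simplex. [folklore] -/
lemma isRelEilenberg {q : ℕ} {η : SingularSimplex X q} (hσ : IsRelEilenberg₁ A x₀ m η) :
    IsRelEilenberg A x₀ m η :=
  ⟨hσ.1, hσ.apply_vertex⟩

/-- Faces of such simplices are such simplices. [folklore] -/
lemma face {q : ℕ} {η : SingularSimplex X (q + 1)} (hσ : IsRelEilenberg₁ A x₀ m η) (i : Fin (q + 2)) :
    IsRelEilenberg₁ A x₀ m (η.face i) := by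
  refine ⟨fun t ht => ?_, fun t ht => ?_⟩
  · rw [SingularSimplex.toContinuousMap_face_apply]
    exact hσ.1 _ (stdFace_mem_stdSkel i ht)
  · rw [SingularSimplex.toContinuousMap_face_apply]
    exact hσ.2 _ (stdFace_mem_stdSkel i ht)

end IsRelEilenberg₁

/-- The constant simplex at `x₀ ∈ A` is such a simplex. [folklore] -/
lemma isRelEilenberg₁_ofMap_const {A : Set X} {x₀ : X} (hx₀ : x₀ ∈ A) (m q : ℕ) :
    IsRelEilenberg₁ A x₀ m (SingularSimplex.ofMap (ContinuousMap.const (StdSimplex q) x₀)) :=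
  ⟨fun t _ => by rw [SingularSimplex.toContinuousMap_ofMap]; exact hx₀,
    fun t _ => by rw [SingularSimplex.toContinuousMap_ofMap]; rfl⟩

/-! ### Retractions -/

variable (X) in
/-- **A relative Eilenberg retraction of level `m` with normalised `1`-skeleta**: as
`RelEilenbergRetraction X A x₀ m` (Spanier 1981, Lemma 7.4.7 (b), (c), proof of Thm. 7.4.8), but onto
the simplices with `m`-skeleton in `A` and `1`-skeleton at `x₀`. [cite: Spanier1981, Ch. 7 §4 Lemma 7 and Thm. 8] -/
structure RelEilenbergRetraction₁ (A : Set X) (x₀ : X) (m : ℕ) where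
  /-- the retraction `σ ↦ σ̄` on singular simplices of each dimension -/
  ρ : ∀ {q : ℕ}, SingularSimplex X q → SingularSimplex X q
  /-- `ρ` commutes with the face maps -/
  face_ρ : ∀ {q : ℕ} (η : SingularSimplex X (q + 1)) (i : Fin (q + 2)), (ρ η).face i = ρ (η.face i)
  /-- `ρ σ` has `m`-skeleton in `A` and `1`-skeleton at `x₀` -/
  isRelEilenberg₁_ρ : ∀ {q : ℕ} (η : SingularSimplex X q), IsRelEilenberg₁ A x₀ m (ρ η)
  /-- `ρ` is the identity on such simplices -/
  ρ_eq_self : ∀ {q : ℕ} (η : SingularSimplex X q), IsRelEilenberg₁ A x₀ m η → ρ η = η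
  /-- `ρ` maps simplices of `A` to simplices of `A` -/
  range_ρ_subset : ∀ {q : ℕ} (η : SingularSimplex X q), η.range ⊆ A → (ρ η).range ⊆ A

namespace RelEilenbergRetraction₁

variable (R : Type v) [CommRing R] (M : Type v) [AddCommGroup M] [Module R M]
variable {A : Set X} {x₀ : X} {m : ℕ} (E : RelEilenbergRetraction₁ X A x₀ m)

/-- The chain map `ρ♯` on concrete singular chains, `∑ nᵢ σᵢ ↦ ∑ nᵢ ρ(σᵢ)`. [cite: Spanier1981, Ch. 7 §4 Lemma 7] -/
def chainMap (q : ℕ) : CChain M X q →ₗ[R] CChain M X q :=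
  Finsupp.lmapDomain M R E.ρ

/-- `ρ♯` on an elementary chain. [folklore] -/
@[simp]
lemma chainMap_single {q : ℕ} (η : SingularSimplex X q) (c : M) :
    E.chainMap R M q (Finsupp.single η c) = Finsupp.single (E.ρ η) c :=
  Finsupp.mapDomain_single

/-- **`ρ♯` is a chain map.** [cite: Spanier1981, Ch. 7 §4 Lemma 7] -/
theorem bd_chainMap {q : ℕ} (c : CChain M X (q + 1)) :
    csingularChainComplex.bd R q (E.chainMap R M (q + 1) c) =
      E.chainMap R M q (csingularChainComplex.bd R q c) := by
  refine Finsupp.induction_linear c (by simp) (fun g g' hg hg' => ?_) fun η n => ?_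
  · rw [map_add, map_add, hg, hg', map_add, map_add]
  · rw [chainMap_single, csingularChainComplex.bd_single, csingularChainComplex.bd_single, map_sum]
    refine Finset.sum_congr rfl fun i _ => ?_
    rw [map_smul, chainMap_single, E.face_ρ]

/-- `ρ♯` fixes the elementary chains of the simplices of the subcomplex. [folklore] -/
lemma chainMap_single_of_isRelEilenberg₁ {q : ℕ} {η : SingularSimplex X q} (hσ : IsRelEilenberg₁ A x₀ m η)
    (c : M) : E.chainMap R M q (Finsupp.single η c) = Finsupp.single η c := by
  rw [chainMap_single, E.ρ_eq_self η hσ]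

/-- Every simplex occurring in `ρ♯ c` lies in the subcomplex. [folklore] -/
lemma isRelEilenberg₁_of_mem_support_chainMap {q : ℕ} (c : CChain M X q) {η : SingularSimplex X q}
    (hσ : η ∈ (E.chainMap R M q c).support) : IsRelEilenberg₁ A x₀ m η := by
  classical
  obtain ⟨η', -, rfl⟩ := Finset.mem_image.1 (Finsupp.mapDomain_support hσ)
  exact E.isRelEilenberg₁_ρ η'

/-- **`ρ♯` preserves the chains of `A`.** [folklore] -/
lemma chainMap_mem_chainsIn {q : ℕ} {c : CChain M X q} (hc : c ∈ chainsIn R M X A q) :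
    E.chainMap R M q c ∈ chainsIn R M X A q := by
  classical
  rw [mem_chainsIn_iff] at hc ⊢
  intro η hσ
  obtain ⟨η', hσ', rfl⟩ := Finset.mem_image.1 (Finsupp.mapDomain_support hσ)
  exact E.range_ρ_subset η' (hc η' hσ')

/-! ### The tower -/

/-- **The properties of the level-`q` homotopies** (as `RelEilenbergRetraction.LevelGood`, with the
end maps sending the `1`-skeleton to `x₀`). [cite: Spanier1981, Ch. 7 §4 Lemma 7] -/
structure LevelGood₁ (A : Set X) (x₀ : X) (m q : ℕ)
    (P : SingularSimplex X q → C(StdSimplex q × I, X)) : Prop where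
  /-- (a) the homotopy starts at the simplex -/
  bot : ∀ (η : SingularSimplex X q) (t : StdSimplex q), P η (t, 0) = toContinuousMap η t
  /-- (b) the end map sends the `1`-skeleton to `x₀` -/
  one : ∀ (η : SingularSimplex X q), ∀ t ∈ stdSkel q 1, P η (t, 1) = x₀
  /-- (b) the end map sends the `m`-skeleton into `A` -/
  skel : ∀ (η : SingularSimplex X q), ∀ t ∈ stdSkel q m, P η (t, 1) ∈ A
  /-- (b) the homotopy is constant on the simplices of the subcomplex -/
  const : ∀ (η : SingularSimplex X q), IsRelEilenberg₁ A x₀ m η →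
    ∀ (t : StdSimplex q) (s : I), P η (t, s) = toContinuousMap η t
  /-- (A) the homotopy stays in `A` for simplices of `A` -/
  inA : ∀ (η : SingularSimplex X q), η.range ⊆ A → ∀ (t : StdSimplex q) (s : I), P η (t, s) ∈ A
  /-- stationary from time `τ_q` on -/
  stat : ∀ (η : SingularSimplex X q) (t : StdSimplex q) (s : I), tau q ≤ (s : ℝ) → P η (t, s) = P η (t, 1)
  /-- the face homotopies of every `(q+1)`-simplex are compatible -/
  compat : ∀ τ : SingularSimplex X (q + 1), SimplexPrism.Compatible fun i => P (τ.face i)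

variable {A : Set X} {x₀ : X} {m : ℕ}

section Tower

variable [PathConnectedSpace X] [PathConnectedSpace A] (x₀ : A)

/-- **Level `0`**: the paths of `RelativeEilenbergRetractionProofs.lean` (to `x₀`, inside `A` for
points of `A`, constant at `x₀`). [cite: Spanier1981, Ch. 7 §4 Thm. 8] -/
theorem exists_level_zero₁ (m : ℕ) :
    ∃ P : SingularSimplex X 0 → C(StdSimplex 0 × I, X), LevelGood₁ A (x₀ : X) m 0 P := by
  let P : SingularSimplex X 0 → C(StdSimplex 0 × I, X) := fun ρ =>
    (RelEilenbergRetraction.levelZeroPath A x₀ (toContinuousMap ρ (Classical.arbitrary _))).comp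
      ContinuousMap.snd
  have hP : ∀ (ρ : SingularSimplex X 0) (t : StdSimplex 0) (s : I),
      P ρ (t, s) = RelEilenbergRetraction.levelZeroPath A x₀ (toContinuousMap ρ (Classical.arbitrary _)) s :=
    fun _ _ _ => rfl
  have ht : ∀ t : StdSimplex 0, t = Classical.arbitrary _ := fun t =>
    Subsingleton.elim (α := stdSimplex ℝ (Fin 1)) t _
  refine ⟨P, ⟨fun ρ t => ?_, fun ρ t _ => ?_, fun ρ t _ => ?_, fun ρ hρ t s => ?_, fun ρ hρ t s => ?_,
    fun ρ t s hs => ?_, fun τ => EilenbergRetraction.compatible_faces_zero P τ⟩⟩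
  · rw [hP, RelEilenbergRetraction.levelZeroPath_zero, ← ht t]
  · rw [hP, RelEilenbergRetraction.levelZeroPath_one]
  · rw [hP, RelEilenbergRetraction.levelZeroPath_one]; exact x₀.2
  · have h0 : toContinuousMap ρ (Classical.arbitrary _) = x₀ :=
      hρ.2 _ (by rw [stdSkel_eq_univ (Nat.zero_le 1)]; exact mem_univ _)
    rw [hP, h0, RelEilenbergRetraction.levelZeroPath_self, ← h0, ← ht t]
  · rw [hP]; exact RelEilenbergRetraction.levelZeroPath_mem x₀ (hρ ⟨_, rfl⟩) s
  · rw [hP, hP, RelEilenbergRetraction.levelZeroPath_of_half_le x₀ _ s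
      (by rw [RelativeDeformation.tau_zero] at hs; exact hs)]

omit [PathConnectedSpace X] [PathConnectedSpace A] in
/-- **Level `1` from level `0`** (the new step): the prism over an edge is filled with the lid AT
`x₀` — inside `↥A` for edges of `A` (`π₁(A) = 0`), in `X` otherwise (`π₁(X) = 0`), constant for
edges already at `x₀`. [cite: Spanier1981, Ch. 7 §4 Thm. 8] -/
theorem exists_level_one₁ [SimplyConnectedSpace X] [SimplyConnectedSpace A]
    (P : SingularSimplex X 0 → C(StdSimplex 0 × I, X)) (hP : LevelGood₁ A (x₀ : X) m 0 P) :
    ∃ P' : SingularSimplex X 1 → C(StdSimplex 1 × I, X),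
      LevelGood₁ A (x₀ : X) m 1 P' ∧
      ∀ (η : SingularSimplex X 1) (i : Fin 2) (t : StdSimplex 0) (s : I),
        P' η (stdFace i t, s) = P (η.face i) (t, s) := by
  have hbot : ∀ (η : SingularSimplex X 1) (i : Fin 2) (t : StdSimplex 0),
      P (η.face i) (t, 0) = toContinuousMap η (stdFace i t) := fun η i t => by
    rw [hP.bot, toContinuousMap_face_apply]
  have hstat : ∀ (η : SingularSimplex X 1) (i : Fin 2) (t : StdSimplex 0) (s : I),
      tau 0 ≤ (s : ℝ) → P (η.face i) (t, s) = P (η.face i) (t, 1) := fun η i t s hs => hP.stat _ t s hs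
  have hend : ∀ (η : SingularSimplex X 1) (i : Fin 2) (t : StdSimplex 0), P (η.face i) (t, 1) = x₀ :=
    fun η i t => hP.one _ t (by rw [stdSkel_eq_univ (Nat.zero_le 1)]; exact mem_univ _)
  have htau : tau 1 = (1 + tau 0) / 2 := RelativeDeformation.tau_succ 0
  have key : ∀ η : SingularSimplex X 1, ∃ G : C(StdSimplex 1 × I, X),
      (∀ t, G (t, 0) = toContinuousMap η t) ∧
        (∀ (i : Fin 2) (t : StdSimplex 0) (s : I), G (stdFace i t, s) = P (η.face i) (t, s)) ∧
        (∀ (t : StdSimplex 1) (s : I), tau 1 ≤ (s : ℝ) → G (t, s) = G (t, 1)) ∧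
        (∀ t : StdSimplex 1, G (t, 1) = x₀) ∧
        (IsRelEilenberg₁ A x₀ m η → ∀ (t : StdSimplex 1) (s : I), G (t, s) = toContinuousMap η t) ∧
        (η.range ⊆ A → ∀ (t : StdSimplex 1) (s : I), G (t, s) ∈ A) := by
    intro η
    by_cases hη : IsRelEilenberg₁ A x₀ m η
    · refine ⟨(toContinuousMap η).comp ContinuousMap.fst, fun t => rfl, fun i t s => ?_,
        fun t s _ => rfl, fun t => hη.2 t (by rw [stdSkel_eq_univ le_rfl]; exact mem_univ _),
        fun _ t s => rfl, fun hA t s => hA ⟨t, rfl⟩⟩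
      show toContinuousMap η (stdFace i t) = P (η.face i) (t, s)
      rw [hP.const _ (hη.face i), toContinuousMap_face_apply]
    by_cases hA : η.range ⊆ A
    · -- an edge of `A`: fill inside `↥A` with the lid at `x₀`, by `π₁(A) = 0`
      have hfaceA : ∀ i : Fin 2, (η.face i).range ⊆ A := fun i => (range_face_subset i η).trans hA
      let B : Set A := {x₀}
      haveI : PathConnectedSpace B := isPathConnected_iff_pathConnectedSpace.1 (isPathConnected_singleton x₀)
      have hπB : ∀ b : B, Subsingleton (RelHomotopyGroup.Pi (0 + 1) A B b) := fun b =>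
        subsingleton_relHomotopyGroup_one_of_simplyConnectedSpace B b
      let fA : C(StdSimplex 1, A) :=
        ⟨fun t => ⟨toContinuousMap η t, hA ⟨t, rfl⟩⟩, (toContinuousMap η).continuous.subtype_mk _⟩
      let FA : Fin 2 → C(StdSimplex 0 × I, A) := fun i =>
        ⟨fun p => ⟨P (η.face i) p, hP.inA _ (hfaceA i) p.1 p.2⟩, (P (η.face i)).continuous.subtype_mk _⟩
      have hFA : SimplexPrism.Compatible FA := fun i j t t' s h => Subtype.ext (hP.compat η i j t t' s h)
      have hbotA : ∀ i t, FA i (t, 0) = fA (stdFace i t) := fun i t => Subtype.ext (hbot η i t)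
      have hstatA : ∀ i t (s : I), tau 0 ≤ (s : ℝ) → FA i (t, s) = FA i (t, 1) :=
        fun i t s hs => Subtype.ext (hstat η i t s hs)
      have hendA : ∀ i t, FA i (t, 1) ∈ B := fun i t =>
        show FA i (t, 1) = x₀ from Subtype.ext (hend η i t)
      obtain ⟨GA, hGA0, hGAs, hGAst, hGA1⟩ :=
        RelativeCompression.exists_fill_into hπB fA FA hFA hbotA (tau_pos 0) (tau_lt_one 0) hstatA hendA
      let G : C(StdSimplex 1 × I, X) := ⟨fun p => (GA p : X), continuous_subtype_val.comp GA.continuous⟩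
      have hG : ∀ p, G p = (GA p : X) := fun _ => rfl
      refine ⟨G, fun t => by rw [hG, hGA0]; rfl, fun i t s => by rw [hG, hGAs]; rfl,
        fun t s hs => by rw [hG, hG, hGAst t s (by rw [htau] at hs; exact hs)],
        fun t => ?_, fun h => absurd h hη, fun _ t s => (GA (t, s)).2⟩
      rw [hG]
      exact congrArg Subtype.val (hGA1 t)
    · -- an edge not in `A`: fill in `X` with the lid at `x₀`, by `π₁(X) = 0`
      let B : Set X := {(x₀ : X)}
      haveI : PathConnectedSpace B := isPathConnected_iff_pathConnectedSpace.1 (isPathConnected_singleton _)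
      have hπB : ∀ b : B, Subsingleton (RelHomotopyGroup.Pi (0 + 1) X B b) := fun b =>
        subsingleton_relHomotopyGroup_one_of_simplyConnectedSpace B b
      obtain ⟨G, hG0, hGs, hGst, hG1⟩ := RelativeCompression.exists_fill_into hπB
        (toContinuousMap η) (fun i => P (η.face i)) (hP.compat η) (hbot η) (tau_pos 0) (tau_lt_one 0)
        (hstat η) (fun i t => hend η i t)
      exact ⟨G, hG0, hGs, fun t s hs => hGst t s (by rw [htau] at hs; exact hs), fun t => hG1 t,
        fun h => absurd h hη, fun h => absurd h hA⟩
  choose P' hB' hS' hSt' hT' hC' hA' using key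
  exact ⟨P', ⟨hB', fun η t _ => hT' η t, fun η t _ => by rw [hT']; exact x₀.2, hC', hA', hSt',
    EilenbergRetraction.compatible_faces_succ P' P hS'⟩, hS'⟩

/-- A point of the `1`-skeleton of `Δ^{q+2}` lies on a facet, at a point of the facet's `1`-skeleton.
[folklore] -/
lemma exists_eq_stdFace_of_mem_stdSkel_one {q : ℕ} {t : StdSimplex (q + 2)} (ht : t ∈ stdSkel (q + 2) 1) :
    ∃ (i : Fin (q + 3)) (z : StdSimplex (q + 1)), stdFace i z = t ∧ z ∈ stdSkel (q + 1) 1 := by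
  have ht' : t ∈ stdBoundary (q + 2) := by
    rw [stdBoundary_eq_stdSkel]; exact stdSkel_mono _ (by omega) ht
  obtain ⟨i, hi⟩ := ht'
  obtain ⟨z, rfl⟩ := exists_stdFace_eq i t hi
  exact ⟨i, z, rfl, (stdFace_mem_stdSkel_iff i z).1 ht⟩

omit [PathConnectedSpace X] [PathConnectedSpace A] in
/-- **Level `q + 2` from level `q + 1`** (as `RelEilenbergRetraction.exists_level_succ`; the
`1`-skeleton of the lid is at `x₀` because it lies on the faces). [cite: Spanier1981, Ch. 7 §4 Thm. 8] -/
theorem exists_level_succ_succ₁ {q : ℕ}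
    (hπ : ∀ (j : ℕ) [NeZero j], j ≤ m → ∀ b : A, Subsingleton (RelHomotopyGroup.Pi j X A b))
    (P : SingularSimplex X (q + 1) → C(StdSimplex (q + 1) × I, X)) (hP : LevelGood₁ A x₀ m (q + 1) P) :
    ∃ P' : SingularSimplex X (q + 2) → C(StdSimplex (q + 2) × I, X),
      LevelGood₁ A x₀ m (q + 2) P' ∧
      ∀ (η : SingularSimplex X (q + 2)) (i : Fin (q + 3)) (t : StdSimplex (q + 1)) (s : I),
        P' η (stdFace i t, s) = P (η.face i) (t, s) := by
  have hbot : ∀ (η : SingularSimplex X (q + 2)) (i : Fin (q + 3)) (t : StdSimplex (q + 1)),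
      P (η.face i) (t, 0) = toContinuousMap η (stdFace i t) := fun η i t => by
    rw [hP.bot, toContinuousMap_face_apply]
  have hstat : ∀ (η : SingularSimplex X (q + 2)) (i : Fin (q + 3)) (t : StdSimplex (q + 1)) (s : I),
      tau (q + 1) ≤ (s : ℝ) → P (η.face i) (t, s) = P (η.face i) (t, 1) :=
    fun η i t s hs => hP.stat _ t s hs
  have htau : tau (q + 2) = (1 + tau (q + 1)) / 2 := RelativeDeformation.tau_succ (q + 1)
  -- the `1`-skeleton of the lid of a filling with the prescribed sides is at `x₀`
  have hone : ∀ (η : SingularSimplex X (q + 2)) (G : C(StdSimplex (q + 2) × I, X)),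
      (∀ (i : Fin (q + 3)) (t : StdSimplex (q + 1)) (s : I), G (stdFace i t, s) = P (η.face i) (t, s)) →
        ∀ t ∈ stdSkel (q + 2) 1, G (t, 1) = x₀ := by
    intro η G hGs t ht
    obtain ⟨i, z, rfl, hz⟩ := exists_eq_stdFace_of_mem_stdSkel_one ht
    rw [hGs, hP.one _ z hz]
  have key : ∀ η : SingularSimplex X (q + 2), ∃ G : C(StdSimplex (q + 2) × I, X),
      (∀ t, G (t, 0) = toContinuousMap η t) ∧
        (∀ (i : Fin (q + 3)) (t : StdSimplex (q + 1)) (s : I), G (stdFace i t, s) = P (η.face i) (t, s)) ∧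
        (∀ (t : StdSimplex (q + 2)) (s : I), tau (q + 2) ≤ (s : ℝ) → G (t, s) = G (t, 1)) ∧
        (∀ t ∈ stdSkel (q + 2) m, G (t, 1) ∈ A) ∧
        (IsRelEilenberg₁ A x₀ m η → ∀ (t : StdSimplex (q + 2)) (s : I), G (t, s) = toContinuousMap η t) ∧
        (η.range ⊆ A → ∀ (t : StdSimplex (q + 2)) (s : I), G (t, s) ∈ A) := by
    intro η
    by_cases hη : IsRelEilenberg₁ A x₀ m η
    · refine ⟨(toContinuousMap η).comp ContinuousMap.fst, fun t => rfl, fun i t s => ?_,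
        fun t s _ => rfl, fun t ht => hη.1 t ht, fun _ t s => rfl, fun hA t s => hA ⟨t, rfl⟩⟩
      show toContinuousMap η (stdFace i t) = P (η.face i) (t, s)
      rw [hP.const _ (hη.face i), toContinuousMap_face_apply]
    by_cases hA : η.range ⊆ A
    · -- `η ⊆ A`: fill inside the subspace `A`
      have hfaceA : ∀ i : Fin (q + 3), (η.face i).range ⊆ A := fun i => (range_face_subset i η).trans hA
      let fA : C(StdSimplex (q + 2), A) :=
        ⟨fun t => ⟨toContinuousMap η t, hA ⟨t, rfl⟩⟩, (toContinuousMap η).continuous.subtype_mk _⟩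
      let FA : Fin (q + 3) → C(StdSimplex (q + 1) × I, A) := fun i =>
        ⟨fun p => ⟨P (η.face i) p, hP.inA _ (hfaceA i) p.1 p.2⟩, (P (η.face i)).continuous.subtype_mk _⟩
      have hFA : SimplexPrism.Compatible FA := fun i j t t' s h => Subtype.ext (hP.compat η i j t t' s h)
      have hbotA : ∀ i t, FA i (t, 0) = fA (stdFace i t) := fun i t => Subtype.ext (hbot η i t)
      have hstatA : ∀ i t (s : I), tau (q + 1) ≤ (s : ℝ) → FA i (t, s) = FA i (t, 1) :=
        fun i t s hs => Subtype.ext (hstat η i t s hs)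
      obtain ⟨GA, hGA0, hGAs, hGAst⟩ :=
        RelativeCompression.exists_fill_stationary fA FA hFA hbotA (tau_pos (q + 1)) (tau_le_one (q + 1)) hstatA
      let G : C(StdSimplex (q + 2) × I, X) := ⟨fun p => (GA p : X), continuous_subtype_val.comp GA.continuous⟩
      have hG : ∀ p, G p = (GA p : X) := fun _ => rfl
      have hGs : ∀ (i : Fin (q + 3)) (t : StdSimplex (q + 1)) (s : I), G (stdFace i t, s) = P (η.face i) (t, s) :=
        fun i t s => by rw [hG, hGAs]; rfl
      refine ⟨G, fun t => by rw [hG, hGA0]; rfl, hGs, fun t s hs => ?_, fun t _ => (GA (t, 1)).2,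
        fun h => absurd h hη, fun _ t s => (GA (t, s)).2⟩
      rw [hG, hG, hGAst t s ((tau_lt_succ (q + 1)).le.trans hs)]
    by_cases hqm : q + 2 ≤ m
    · -- `q + 2 ≤ m`: fill with the lid in `A`, using `π_{q+2}(X, A, ·) = 0`
      have hend : ∀ (i : Fin (q + 3)) (t : StdSimplex (q + 1)), P (η.face i) (t, 1) ∈ A :=
        fun i t => hP.skel _ t (by rw [stdSkel_eq_univ (show q + 1 ≤ m by omega)]; exact mem_univ _)
      obtain ⟨G, hG0, hGs, hGst, hG1⟩ := RelativeCompression.exists_fill_into (hπ (q + 2) hqm)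
        (toContinuousMap η) (fun i => P (η.face i)) (hP.compat η) (hbot η) (tau_pos (q + 1)) (tau_lt_one (q + 1))
        (hstat η) hend
      exact ⟨G, hG0, hGs, fun t s hs => hGst t s (by rw [htau] at hs; exact hs), fun t _ => hG1 t,
        fun h => absurd h hη, fun h => absurd h hA⟩
    · -- `q + 2 > m`: any stationary extension
      obtain ⟨G, hG0, hGs, hGst⟩ := RelativeCompression.exists_fill_stationary (toContinuousMap η)
        (fun i => P (η.face i)) (hP.compat η) (hbot η) (tau_pos (q + 1)) (tau_le_one (q + 1)) (hstat η)
      refine ⟨G, hG0, hGs, fun t s hs => hGst t s ((tau_lt_succ (q + 1)).le.trans hs), fun t ht => ?_,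
        fun h => absurd h hη, fun h => absurd h hA⟩
      have ht' : t ∈ stdBoundary (q + 2) := by
        rw [stdBoundary_eq_stdSkel]; exact stdSkel_mono _ (by omega) ht
      obtain ⟨i, hi⟩ := ht'
      obtain ⟨z, rfl⟩ := exists_stdFace_eq i t hi
      rw [hGs]
      exact hP.skel _ z ((stdFace_mem_stdSkel_iff i z).1 ht)
  choose P' hB' hS' hSt' hT' hC' hA' using key
  exact ⟨P', ⟨hB', fun η => hone η (P' η) (hS' η), hT', hC', hA', hSt',
    EilenbergRetraction.compatible_faces_succ P' P hS'⟩, hS'⟩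

end Tower

end RelEilenbergRetraction₁

/-! ### Existence -/

open SingularSimplex in
/-- **Relative Eilenberg retractions with normalised `1`-skeleta exist** when `X` and `↥A` are
simply connected and `π_q(X, A, b) = 0` for `1 ≤ q ≤ m` and all `b ∈ A` (Spanier 1981, Ch. 7 §4,
Thm. 8, by the inductive construction of its proof, p. 393, run inside `A` first and with the edges
contracted to `x₀`). [cite: Spanier1981, Ch. 7 §4 Thm. 8] -/
theorem exists_relEilenbergRetraction₁ [SimplyConnectedSpace X] (A : Set X) [SimplyConnectedSpace A]
    (m : ℕ) (hπ : ∀ (q : ℕ) [NeZero q], q ≤ m → ∀ b : A, Subsingleton (RelHomotopyGroup.Pi q X A b))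
    (x₀ : A) : Nonempty (RelEilenbergRetraction₁ X A (x₀ : X) m) := by
  -- the tower: levels `0`, `1`, and then `q + 1 ↦ q + 2`
  let T₀ : {P : SingularSimplex X 0 → C(StdSimplex 0 × I, X) //
      RelEilenbergRetraction₁.LevelGood₁ A (x₀ : X) m 0 P} :=
    ⟨(RelEilenbergRetraction₁.exists_level_zero₁ x₀ m).choose,
      (RelEilenbergRetraction₁.exists_level_zero₁ x₀ m).choose_spec⟩
  let step : ∀ q : ℕ, {P : SingularSimplex X q → C(StdSimplex q × I, X) //
        RelEilenbergRetraction₁.LevelGood₁ A (x₀ : X) m q P} →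
      {P : SingularSimplex X (q + 1) → C(StdSimplex (q + 1) × I, X) //
        RelEilenbergRetraction₁.LevelGood₁ A (x₀ : X) m (q + 1) P} := fun q =>
    Nat.casesOn (motive := fun q => {P : SingularSimplex X q → C(StdSimplex q × I, X) //
        RelEilenbergRetraction₁.LevelGood₁ A (x₀ : X) m q P} →
      {P : SingularSimplex X (q + 1) → C(StdSimplex (q + 1) × I, X) //
        RelEilenbergRetraction₁.LevelGood₁ A (x₀ : X) m (q + 1) P}) q
      (fun s => ⟨(RelEilenbergRetraction₁.exists_level_one₁ x₀ s.1 s.2).choose,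
        (RelEilenbergRetraction₁.exists_level_one₁ x₀ s.1 s.2).choose_spec.1⟩)
      (fun q s => ⟨(RelEilenbergRetraction₁.exists_level_succ_succ₁ x₀ hπ s.1 s.2).choose,
        (RelEilenbergRetraction₁.exists_level_succ_succ₁ x₀ hπ s.1 s.2).choose_spec.1⟩)
  let T := fun q : ℕ =>
    Nat.rec (motive := fun q => {P : SingularSimplex X q → C(StdSimplex q × I, X) //
        RelEilenbergRetraction₁.LevelGood₁ A (x₀ : X) m q P}) T₀ step q
  -- (c): consecutive levels are compatible with the faces
  have hF : ∀ (q : ℕ) (η : SingularSimplex X (q + 1)) (i : Fin (q + 2)) (t : StdSimplex q) (s : I),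
      (T (q + 1)).1 η (stdFace i t, s) = (T q).1 (η.face i) (t, s) := by
    intro q
    cases q with
    | zero => exact (RelEilenbergRetraction₁.exists_level_one₁ x₀ (T 0).1 (T 0).2).choose_spec.2
    | succ q => exact (RelEilenbergRetraction₁.exists_level_succ_succ₁ x₀ hπ (T (q + 1)).1 (T (q + 1)).2).choose_spec.2
  refine ⟨{ ρ := fun {q} η => ofMap ⟨fun t => (T q).1 η (t, 1),
              ((T q).1 η).continuous.comp (continuous_id.prodMk continuous_const)⟩
            face_ρ := fun {q} η i => ?_
            isRelEilenberg₁_ρ := fun {q} η => ⟨fun t ht => ?_, fun t ht => ?_⟩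
            ρ_eq_self := fun {q} η hη => ?_
            range_ρ_subset := fun {q} η hη => ?_ }⟩
  · rw [ofMap_face]
    congr 1
    ext t
    exact hF q η i t 1
  · rw [toContinuousMap_ofMap]
    exact (T q).2.skel η t ht
  · rw [toContinuousMap_ofMap]
    exact (T q).2.one η t ht
  · conv_rhs => rw [← ofMap_toContinuousMap η]
    congr 1
    ext t
    exact (T q).2.const η hη t 1
  · rintro _ ⟨t, rfl⟩
    rw [toContinuousMap_ofMap]
    exact (T q).2.inA η hη t 1

end Literature.AlgebraicTopology.SingularHomology

end
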